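import Summits.FinalStateConjecture.FinalStateConjecture.Theorems.PhotonSphereChannelsChannelsResolveTameDevelopmentsRKerrDevTransport
import Literature.Geometry.Lorentzian.SpacetimeLocalConvergenceRestrict
import HarnessLib

/-!
# Route PhotonSphereChannels · crux `ChannelsResolveTameDevelopmentsR` (K2R) — `kerrDev` can only grow under
# passage to open sub-spacetimes (line `kerr-isolation-dichotomy`; supports stub S1 `stub_silentHullExtraction`)

`Spacetime.SubconvergesLocallyTo` has no covering clause, so every connected open neighbourhood `W` of the
base point of a pointed `Cᵏ_loc` limit is again a limit (`SubconvergesLocallyTo.restrict'`,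
`SpacetimeLocalConvergenceRestrict.lean`). For the `∃`-statement S1 this trimming is harmless, and the
present file records WHY for its deviation dictionary: the anchored Kerr window deviation of the TRIMMED
limit dominates that of the limit,

* `kerrDev_le_kerrDev_restrict` / `kerrDev_le_kerrDev_restrict'` — `kerrDev 𝓢 q R ≤ kerrDev (𝓢|_W) ⟨q, hq⟩ R`,

because the inclusion `W ↪ 𝓢` is a smooth injective isometric immersion preserving the time orientations
(`kerrDev_comp_le` of `…RKerrDevTransport.lean`): an anchored window chart into `W` is one into `𝓢` with the
same deviation. Hence a hypothesis `kerrDev (limit) < ε` only becomes HARDER to satisfy after trimming, and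
the dictionary `kerrDev 𝓢 p R < ε → ∀ᶠ n, kerrDev 𝒟 (q (φ n)) R < ε` for a limit implies it for all its
trimmings. References: O'Neill 1983, Ch. 3 p. 57 (open submanifolds) [ONeill1983]; Petersen 2006, Ch. 10
§3.2 [Petersen2006].
-/

noncomputable section

-- the operator-norm instance on `E4 →L[ℝ] E4 →L[ℝ] ℝ` needs one more level of pending
-- instance problems than the default (as in `PhotonSphereChannelsKerrDevDefs.lean`)
set_option maxSynthPendingDepth 3
-- every `Summit.FinalStateConjecture.FinalStateConjecture.…` name repeats the summit = sub-problem segment (D-0017 layout)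
set_option linter.dupNamespace false

open Set Filter Function TopologicalSpace Manifold Bundle
open scoped Topology Manifold ContDiff ENNReal NNReal

namespace Summit.FinalStateConjecture.FinalStateConjecture.Theorems

open Literature.Geometry.Lorentzian
open Summit.FinalStateConjecture.FinalStateConjecture.Theorems.TameHull

/-- The inclusion of an open sub-spacetime is isometric: `ι^* g = g|_W` (the inclusion has identity
differential, `OpenSubmanifold.mfderiv_subtype_val`). [cite: ONeill1983, Ch. 3  p. 57] -/
theorem pullbackBilin_subtypeVal_restrict : ∀ (𝓢 : Spacetime.{0} 4) (hres : PseudoRiemannianMetric.contMDiff_restrict (I := 𝓡 4) (n := ∞) (M := 𝓢.carrier)) (hτ : 𝓢.timeOrientation.contMDiff_restrict) (W : Opens 𝓢.carrier) (hW : IsConnected (W : Set 𝓢.carrier)) (y : (𝓢.restrict hres hτ W hW).carrier), pullbackBilin (I := 𝓡 4) (I' := 𝓡 4) (Subtype.val : (𝓢.restrict hres hτ W hW).carrier → 𝓢.carrier) 𝓢.metric.val y = (𝓢.restrict hres hτ W hW).metric.val y := by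
  intro 𝓢 hres hτ W hW y
  ext v w
  rw [pullbackBilin_apply, Literature.Geometry.Manifold.OpenSubmanifold.mfderiv_subtype_val]
  rfl

/-- The inclusion of an open sub-spacetime preserves the time orientations: its differential (the
identity) maps the restricted orienting field to the orienting field — the body of
`TimeOrientation.PreservesTimeOrientation Subtype.val`, stated unfolded. [cite: ONeill1983, Ch. 5  p. 145] -/
theorem isFutureDirected_mfderiv_subtypeVal_restrict : ∀ (𝓢 : Spacetime.{0} 4) (hres : PseudoRiemannianMetric.contMDiff_restrict (I := 𝓡 4) (n := ∞) (M := 𝓢.carrier)) (hτ : 𝓢.timeOrientation.contMDiff_restrict) (W : Opens 𝓢.carrier) (hW : IsConnected (W : Set 𝓢.carrier)) (y : (𝓢.restrict hres hτ W hW).carrier), 𝓢.timeOrientation.IsFutureDirected (mfderiv (𝓡 4) (𝓡 4) (Subtype.val : (𝓢.restrict hres hτ W hW).carrier → 𝓢.carrier) y ((𝓢.restrict hres hτ W hW).timeOrientation.vectorField y)) := by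
  intro 𝓢 hres hτ W hW y
  rw [Literature.Geometry.Manifold.OpenSubmanifold.mfderiv_subtype_val]
  exact 𝓢.timeOrientation.isFutureDirected_vectorField y.1

/-- **`kerrDev` can only grow under trimming**: for a connected open `W ∋ q` of `𝓢`,
`kerrDev 𝓢 q R ≤ kerrDev (𝓢|_W) ⟨q, hq⟩ R` (`kerrDev_comp_le` for the inclusion, a smooth injective
isometric immersion preserving the time orientations). [cite: Petersen2006, Ch. 10 §3.2] -/
theorem kerrDev_le_kerrDev_restrict : ∀ (𝓢 : Spacetime.{0} 4) (hres : PseudoRiemannianMetric.contMDiff_restrict (I := 𝓡 4) (n := ∞) (M := 𝓢.carrier)) (hτ : 𝓢.timeOrientation.contMDiff_restrict) (W : Opens 𝓢.carrier) (hW : IsConnected (W : Set 𝓢.carrier)) (q : 𝓢.carrier) (hq : q ∈ W) (R : ℝ), kerrDev 𝓢 q R ≤ kerrDev (𝓢.restrict hres hτ W hW) ⟨q, hq⟩ R := by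
  intro 𝓢 hres hτ W hW q hq R
  exact kerrDev_comp_le (𝓢 := 𝓢.restrict hres hτ W hW) (𝓣 := 𝓢) (F := Subtype.val) contMDiff_subtype_val
    Subtype.val_injective (pullbackBilin_subtypeVal_restrict 𝓢 hres hτ W hW)
    (isFutureDirected_mfderiv_subtypeVal_restrict 𝓢 hres hτ W hW) ⟨q, hq⟩ R

/-- The same with the smoothness-of-restriction hypotheses of `Spacetime.restrict` discharged
(`PseudoRiemannianMetric.contMDiff_restrict_holds`, `TimeOrientation.contMDiff_restrict_holds`), matching
`SubconvergesLocallyTo.restrict'`. [cite: Petersen2006, Ch. 10 §3.2] -/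
theorem kerrDev_le_kerrDev_restrict' : ∀ (𝓢 : Spacetime.{0} 4) (W : Opens 𝓢.carrier) (hW : IsConnected (W : Set 𝓢.carrier)) (q : 𝓢.carrier) (hq : q ∈ W) (R : ℝ), kerrDev 𝓢 q R ≤ kerrDev (𝓢.restrict PseudoRiemannianMetric.contMDiff_restrict_holds 𝓢.timeOrientation.contMDiff_restrict_holds W hW) ⟨q, hq⟩ R :=
  fun 𝓢 W hW q hq R ↦ kerrDev_le_kerrDev_restrict 𝓢 _ _ W hW q hq R

end Summit.FinalStateConjecture.FinalStateConjecture.Theorems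

end
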